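import Summits.AtomisticToContinuum.HydrodynamicLimit.Theorems.BoxDissipativeWeakStrongRelativeEnergyStabilityDefs
import Summits.AtomisticToContinuum.HydrodynamicLimit.Theorems.JParityClosureParityInBandEosExtension
import Summits.AtomisticToContinuum.HydrodynamicLimit.Theorems.JParityClosureParityInBandEos
import Literature.Analysis.FluidPDE.MVRelativeEnergyMaster
import HarnessLib

/-!
# Crux `RelativeEnergyStability` (stmt-AtomisticToContinuum-17653), line `registered`:
helpers of the stub `stub_cutEosMaster` (S-M) — the smooth band extension and the transfer lemmas

BF's master pointwise inequality (`master_pointwise_inequality`, BrezinaFeireisl2018 §3.2.2 (3.9)–(3.11)) is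
proved in tree for Gibbs/stable `C²` laws. Near the reference states the cut hard-sphere law `cutEOS σ η₁`
coincides (values AND derivatives) with the smooth global extension `EulerEOS.monatomicExcess χ f` of
`exists_hsEos_band_extension`; this file makes that usable by S-M:

* `cm_band_extension` (registered helper sub-goal) — the extension with a band edge INDEPENDENT of the
  reduced diameter `σ` (the edge of `exists_global_virial_extension` is produced before `σ` is fixed);
* `cm_ideal_hypotheses` — the monatomic ideal gas is Gibbs, stable, `e > 0`;
* `cm_reducedRHS_congr`, `cm_relEnergyThermo_congr`, `cm_temperatureEq_iff`, `cm_ref_transfer`,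
  `cm_state_transfer` — two monatomic laws agreeing near `d.r` and at the state have the same
  `reducedRHS`, `relEnergyFull`, `TemperatureEq`;
* `cm_reducedRHS_le_lin` — the residual bookkeeping of BF §3.2.2 as a linear bound
  `reducedRHS ≤ A ρ|v|² + B ρ + C₀ + 3M|p(ρ,ϑ)|`, valid down to the vacuum;
* `cm_relEnergyZ_zero`, `cm_relEnergyZ_expand` — the clamped relative energy on the vacuum (`= p(r,Θ)`) and
  expanded off it.

References: BrezinaFeireisl2018 §3.1–3.2; FeireislNovotny2012.
-/

noncomputable section

namespace Summit.AtomisticToContinuum.HydrodynamicLimit.Theorems.RES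

open MeasureTheory Filter Set Metric
open scoped Topology
open Summit.AtomisticToContinuum.HydrodynamicLimit.Theses.BoxDissipativeWeakStrong
open Literature.MathematicalPhysics.KineticTheory Literature.Analysis.FluidPDE
open Literature.Analysis.FluidPDE.CompressibleEuler
open Literature.Analysis.FluidPDE.CompressibleEuler.EulerPhase
open Literature.Analysis.FluidPDE.CompressibleEuler.StrongPointData

/-! ## A smooth band extension of the hard-sphere law, uniform in the diameter -/

/-- **The hard-sphere law, globally extended off the band, with a band edge independent of `σ`.**
Same construction as `exists_hsEos_band_extension` (adapted from
`JParityClosureParityInBandEosExtension.lean`), but the band edge `η₁` is produced from the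
`σ`-independent `exists_global_virial_extension` BEFORE the reduced diameter `σ` is fixed: for every
`σ > 0` there are `χ, f ∈ C²(0,∞)` with the virial relation, `(ρχ)' > 0`, `χ` bounded, and
`f ρ = f_ex(ρσ³)`, `χ ρ = Z(ρσ³)` whenever `0 < ρ`, `ρσ³ ≤ η₁`. -/
theorem cm_band_extension {η₀ : ℝ} {F : ℝ → ℝ} (hη₀ : 0 < η₀) (hF : AnalyticOnNhd ℝ F (Ioo (-η₀) η₀))
    (hEq : EqOn hsExcessFreeEnergy F (Ico 0 η₀)) :
    ∃ η₁ : ℝ, 0 < η₁ ∧ 2 * η₁ < η₀ ∧ ∀ σ : ℝ, 0 < σ → ∃ χ f : ℝ → ℝ,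
      ContDiffOn ℝ 2 χ (Ioi 0) ∧ ContDiffOn ℝ 2 f (Ioi 0) ∧
      (∀ ρ, 0 < ρ → χ ρ = 1 + ρ * deriv f ρ) ∧
      (∀ ρ, 0 < ρ → 0 < χ ρ + ρ * deriv χ ρ) ∧
      (∃ B : ℝ, ∀ ρ, 0 < ρ → |χ ρ| ≤ B) ∧
      (∀ ρ, 0 < ρ → ρ * σ ^ 3 ≤ η₁ →
        f ρ = hsExcessFreeEnergy (ρ * σ ^ 3) ∧ χ ρ = hsCompressibility (ρ * σ ^ 3)) := by
  -- adapted from `exists_hsEos_band_extension` (JParityClosureParityInBandEosExtension.lean)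
  have hF3 : ContDiffOn ℝ 3 F (Ioo (-η₀) η₀) := hF.contDiffOn isOpen_Ioo.uniqueDiffOn
  obtain ⟨η₁, hη₁, hη₁η₀, χt, Ft, hχtc, hFtc, hvir, hstab, ⟨B, hB⟩, hFband, hχband⟩ :=
    exists_global_virial_extension hη₀ hF3
  refine ⟨η₁, hη₁, hη₁η₀, fun σ hσ => ?_⟩
  have hσ3 : 0 < σ ^ 3 := by positivity
  have hmaps : MapsTo (fun ρ : ℝ => ρ * σ ^ 3) (Ioi 0) (Ioi 0) := fun ρ hρ => mul_pos hρ hσ3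
  have hsc : ContDiff ℝ 2 (fun ρ : ℝ => ρ * σ ^ 3) := contDiff_id.mul contDiff_const
  have hFtd : ∀ η, 0 < η → HasDerivAt Ft (deriv Ft η) η := fun η hη =>
    ((hFtc.differentiableOn (by norm_num)).differentiableAt (isOpen_Ioi.mem_nhds hη)).hasDerivAt
  have hχtd : ∀ η, 0 < η → HasDerivAt χt (deriv χt η) η := fun η hη =>
    ((hχtc.differentiableOn (by norm_num)).differentiableAt (isOpen_Ioi.mem_nhds hη)).hasDerivAt
  have hdf : ∀ ρ, 0 < ρ → deriv (fun r => Ft (r * σ ^ 3)) ρ = deriv Ft (ρ * σ ^ 3) * σ ^ 3 :=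
    fun ρ hρ => ((hFtd _ (mul_pos hρ hσ3)).comp ρ (hasDerivAt_mul_const (σ ^ 3))).deriv
  have hdχ : ∀ ρ, 0 < ρ → deriv (fun r => χt (r * σ ^ 3)) ρ = deriv χt (ρ * σ ^ 3) * σ ^ 3 :=
    fun ρ hρ => ((hχtd _ (mul_pos hρ hσ3)).comp ρ (hasDerivAt_mul_const (σ ^ 3))).deriv
  refine ⟨fun ρ => χt (ρ * σ ^ 3), fun ρ => Ft (ρ * σ ^ 3),
    hχtc.comp hsc.contDiffOn hmaps, hFtc.comp hsc.contDiffOn hmaps, ?_, ?_, ⟨B, fun ρ hρ =>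
      hB _ (mul_pos hρ hσ3)⟩, ?_⟩
  · intro ρ hρ
    beta_reduce
    rw [hdf ρ hρ, hvir _ (mul_pos hρ hσ3)]
    ring
  · intro ρ hρ
    beta_reduce
    rw [hdχ ρ hρ]
    have := hstab _ (mul_pos hρ hσ3)
    nlinarith [this]
  · intro ρ hρ hband
    have hη : ρ * σ ^ 3 ∈ Ioc 0 η₁ := ⟨mul_pos hρ hσ3, hband⟩
    have hηU : ρ * σ ^ 3 ∈ Ioo (-η₀) η₀ := ⟨by linarith [hη.1], by linarith [hη.2]⟩
    have hev : hsExcessFreeEnergy =ᶠ[nhds (ρ * σ ^ 3)] F := by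
      have hIoo : Ioo (0 : ℝ) η₀ ∈ nhds (ρ * σ ^ 3) :=
        isOpen_Ioo.mem_nhds ⟨hη.1, hηU.2⟩
      exact Filter.eventually_of_mem hIoo fun x hx => hEq ⟨hx.1.le, hx.2⟩
    refine ⟨?_, ?_⟩
    · beta_reduce
      rw [hFband _ hη]
      exact (hEq ⟨hη.1.le, hηU.2⟩).symm
    · beta_reduce
      rw [hχband _ hη, hsCompressibility, hev.deriv_eq]

/-! ## The monatomic ideal gas -/

/-- The monatomic ideal gas `EulerEOS.monatomicExcess 1 0` (`p = ρϑ`, `e = 3ϑ/2`, `s = 3/2 log ϑ − log ρ`) is a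
Gibbs, thermodynamically stable law with `e > 0` (inputs of the BF coercivity lemmas). -/
theorem cm_ideal_hypotheses :
    (EulerEOS.monatomicExcess (fun _ => 1) (fun _ => 0)).IsGibbs ∧
    (EulerEOS.monatomicExcess (fun _ => 1) (fun _ => 0)).IsThermodynamicallyStable ∧
    (∀ r θ : ℝ, 0 < r → 0 < θ → 0 < (EulerEOS.monatomicExcess (fun _ => 1) (fun _ => 0)).e r θ) := by
  refine ⟨monatomicExcess_isGibbs _ _ contDiffOn_const contDiffOn_const fun ρ _ => by simp,
    monatomicExcess_isThermodynamicallyStable _ _ (fun ρ _ => differentiableAt_const _) fun ρ _ => by simp,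
    fun r θ _ hθ => monatomicExcess_e_pos _ _ r hθ⟩

/-! ## Two monatomic laws that agree near the reference state and at the state -/

section Congr

variable {χ₁ f₁ χ₂ f₂ : ℝ → ℝ}

/-- Relative thermal energies of two monatomic laws agree when `χ, f` agree at `r` and `f` at `ρ`. -/
theorem cm_relEnergyThermo_congr {r Θ ρ ϑ : ℝ} (hχr : χ₁ r = χ₂ r) (hfr : f₁ r = f₂ r)
    (hfρ : f₁ ρ = f₂ ρ) :
    (EulerEOS.monatomicExcess χ₁ f₁).relEnergyThermo r Θ ρ ϑ =
      (EulerEOS.monatomicExcess χ₂ f₂).relEnergyThermo r Θ ρ ϑ := by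
  simp only [EulerEOS.relEnergyThermo, EulerEOS.ballisticFreeEnergy, EulerEOS.chemPotential,
    EulerEOS.monatomicExcess, hχr, hfr, hfρ]

/-- The temperature equations of two monatomic laws at `d` agree when `χ` agrees at `d.r`. -/
theorem cm_temperatureEq_iff {d : StrongPointData} (hχr : χ₁ d.r = χ₂ d.r) :
    d.TemperatureEq (EulerEOS.monatomicExcess χ₁ f₁) ↔
      d.TemperatureEq (EulerEOS.monatomicExcess χ₂ f₂) := by
  simp only [StrongPointData.TemperatureEq, EulerEOS.monatomicExcess, hχr]

/-- The reduced right-hand sides of two monatomic laws (with two cut-offs) at `(d; ρ, E, m)` agree when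
`χ₁ = χ₂` near `d.r`, `f₁(d.r) = f₂(d.r)`, `χ₁ ρ = χ₂ ρ` and the two cut-off entropies agree at the state. -/
theorem cm_reducedRHS_congr {Z₁ Z₂ : ℝ → ℝ} {d : StrongPointData} {ρ E : ℝ}
    {m : EuclideanSpace ℝ (Fin 3)} (hχr : χ₁ =ᶠ[𝓝 d.r] χ₂) (hfr : f₁ d.r = f₂ d.r) (hχρ : χ₁ ρ = χ₂ ρ)
    (hZ : Z₁ ((EulerEOS.monatomicExcess χ₁ f₁).s ρ (2 * E / (3 * ρ))) =
      Z₂ ((EulerEOS.monatomicExcess χ₂ f₂).s ρ (2 * E / (3 * ρ)))) :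
    reducedRHS (EulerEOS.monatomicExcess χ₁ f₁) Z₁ d ρ E m =
      reducedRHS (EulerEOS.monatomicExcess χ₂ f₂) Z₂ d ρ E m := by
  have hχr0 : χ₁ d.r = χ₂ d.r := hχr.eq_of_nhds
  have hp1 : deriv (fun x => x * d.Θ * χ₁ x) d.r = deriv (fun x => x * d.Θ * χ₂ x) d.r := by
    refine Filter.EventuallyEq.deriv_eq ?_
    filter_upwards [hχr] with x hx
    rw [hx]
  simp only [EulerEOS.monatomicExcess] at hZ
  simp only [reducedRHS, StrongPointData.pt, StrongPointData.gp, StrongPointData.pρ,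
    StrongPointData.pϑ, stateTemp, EulerEOS.monatomicExcess, hp1, hχr0, hfr, hχρ, hZ]

end Congr

/-! ## The reduced right-hand side is affine in `ρ|v|², ρ, |p(ρ,ϑ)|` -/

/-- Five signed terms are at most the sum of bounds of their absolute values. -/
theorem cm_combine {t1 t2 t3 t4 t5 B1 B2 B3 B4 B5 : ℝ} (h1 : |t1| ≤ B1) (h2 : |t2| ≤ B2)
    (h3 : |t3| ≤ B3) (h4 : |t4| ≤ B4) (h5 : |t5| ≤ B5) :
    -t1 + t2 - t3 + t4 + t5 ≤ B1 + B2 + B3 + B4 + B5 := by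
  linarith [neg_le_abs t1, le_abs_self t2, neg_le_abs t3, le_abs_self t4, le_abs_self t5]

/-- **Linear bound of the reduced right-hand side** (the residual bookkeeping of BF §3.2.2 without
coercivity): for data bounded by `M` with `|p(r,Θ)| ≤ Pk`, `|s(r,Θ)|, |p_ρ|, |p_ϑ| ≤ Sk`, `r ≥ rmin`, a cut-off
`|Z| ≤ Zb` and a state with `ρ ≥ 0`, `|p(ρ,ϑ)| ≤ Pw`:
`reducedRHS ≤ A ρ|v|² + B ρ + C₀ + 3M·Pw` with explicit `A, B, C₀`. Valid also on the vacuum `ρ = 0`. -/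
theorem cm_reducedRHS_le_lin {eos : EulerEOS} {Z : ℝ → ℝ} {d : StrongPointData}
    {M Pk Sk Zb Pw rmin ρ E : ℝ} {m : EuclideanSpace ℝ (Fin 3)} (hM : 0 ≤ M)
    (hrmin : 0 < rmin) (hr : rmin ≤ d.r) (hρ : 0 ≤ ρ) (hB : d.Bounded M)
    (hPk : |eos.p d.r d.Θ| ≤ Pk) (hSk : |eos.s d.r d.Θ| ≤ Sk) (hpρ : |d.pρ eos| ≤ Sk)
    (hpϑ : |d.pϑ eos| ≤ Sk) (hZb : ∀ x, |Z x| ≤ Zb) (hPw : |eos.p ρ (stateTemp eos ρ E)| ≤ Pw) :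
    reducedRHS eos Z d ρ E m ≤
      (3 * M + (Sk + Zb) * M / 2) * (ρ * ∑ i, (m i / ρ - d.U i) ^ 2) +
        (2 * Sk * (M + 3 * M * M) / rmin + (Sk + Zb) * (M + 3 * M * M) + 3 / 2 * (Sk + Zb) * M) * ρ +
        (3 * M * Pk + 2 * Sk * (M + 3 * M * M)) + 3 * M * Pw := by
  have hr0 : 0 < d.r := hrmin.trans_le hr
  have hSk0 : 0 ≤ Sk := (abs_nonneg _).trans hSk
  have hZb0 : 0 ≤ Zb := (abs_nonneg _).trans (hZb 0)
  have hdiv := hB.abs_divU_le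
  have hDt := hB.abs_DtΘ_le
  have hDr := hB.abs_Dtr_le
  have hsZ : |eos.s d.r d.Θ - Z (eos.s ρ (stateTemp eos ρ E))| ≤ Sk + Zb :=
    (abs_sub _ _).trans (add_le_add hSk (hZb _))
  have hb1 : |ρ * ∑ i, ∑ j, (m i / ρ - d.U i) * (m j / ρ - d.U j) * d.gU i j| ≤
      3 * M * (ρ * ∑ i, (m i / ρ - d.U i) ^ 2) := bound_quad hB.2.2.2.2.2.2 hM hρ
  have hb2 : |(eos.p d.r d.Θ - eos.p ρ (stateTemp eos ρ E)) * d.divU| ≤ (Pk + Pw) * (3 * M) :=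
    abs_mul_le_of_le ((abs_sub _ _).trans (add_le_add hPk hPw)) hdiv
  have hb3 : |(ρ - d.r) / d.r * (d.pt eos + ∑ j, d.U j * d.gp eos j)| ≤
      (ρ / rmin + 1) * (2 * Sk * (M + 3 * M * M)) := by
    rw [pt_add_sum]
    have h1 : |(ρ - d.r) / d.r| ≤ ρ / rmin + 1 := by
      rw [abs_div, abs_of_pos hr0, div_le_iff₀ hr0]
      refine (abs_sub _ _).trans ?_
      rw [abs_of_nonneg hρ, abs_of_pos hr0, add_mul, one_mul]
      have : ρ ≤ ρ / rmin * d.r := by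
        rw [div_mul_eq_mul_div, le_div_iff₀ hrmin]
        exact mul_le_mul_of_nonneg_left hr hρ
      linarith
    have h2 : |d.pρ eos * d.Dtr + d.pϑ eos * d.DtΘ| ≤ 2 * Sk * (M + 3 * M * M) := by
      refine (abs_add_le _ _).trans ?_
      have e1 := abs_mul_le_of_le hpρ hDr
      have e2 := abs_mul_le_of_le hpϑ hDt
      linarith
    exact abs_mul_le_of_le h1 h2
  have hb4 : |ρ * (eos.s d.r d.Θ - Z (eos.s ρ (stateTemp eos ρ E))) * d.DtΘ| ≤
      ρ * (Sk + Zb) * (M + 3 * M * M) := by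
    rw [abs_mul, abs_mul, abs_of_nonneg hρ]
    exact mul_le_mul (mul_le_mul_of_nonneg_left hsZ hρ) hDt (abs_nonneg _) (by positivity)
  have hb5 : |ρ * (eos.s d.r d.Θ - Z (eos.s ρ (stateTemp eos ρ E))) *
      ∑ i, (m i / ρ - d.U i) * d.gΘ i| ≤
      3 / 2 * (Sk + Zb) * M * ρ + (Sk + Zb) * M / 2 * (ρ * ∑ i, (m i / ρ - d.U i) ^ 2) :=
    bound_transport_res hB.2.2.2.2.2.1 hM hρ hsZ
  unfold reducedRHS
  refine (cm_combine hb1 hb2 hb3 hb4 hb5).trans (le_of_eq ?_)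
  field_simp
  ring

/-! ## The clamped relative energy on the vacuum and in expanded form -/

/-- The vacuum state reads `(0, 0, 0)`. -/
theorem cm_zero_phase : dens (0 : EulerPhase) = 0 ∧ ien (0 : EulerPhase) = 0 ∧ mom (0 : EulerPhase) = 0 :=
  ⟨rfl, rfl, rfl⟩

/-- On the vacuum the clamped relative energy is the reference pressure: `ℰ_Z(0 | r,Θ,U) = p(r,Θ)`. -/
theorem cm_relEnergyZ_zero (eos : EulerEOS) (Z : ℝ → ℝ) (d : StrongPointData) :
    d.relEnergyZ eos Z 0 = eos.p d.r d.Θ := by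
  simp [StrongPointData.relEnergyZ, kineticEnergy, cm_zero_phase.1, cm_zero_phase.2.1, cm_zero_phase.2.2]

/-- Off the vacuum the clamped relative energy expands as
`½ρ|v|² + E − ρ μ(r,Θ) − Θ ρ Z(s) + p(r,Θ)` with `v = m/ρ − U`. -/
theorem cm_relEnergyZ_expand (eos : EulerEOS) (Z : ℝ → ℝ) (d : StrongPointData) {w : EulerPhase}
    (hρ : dens w ≠ 0) :
    d.relEnergyZ eos Z w = dens w / 2 * ∑ i, (mom w i / dens w - d.U i) ^ 2 + ien w -
      dens w * eos.chemPotential d.r d.Θ -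
      d.Θ * (dens w * Z (eos.s (dens w) (stateTemp eos (dens w) (ien w)))) + eos.p d.r d.Θ := by
  have hn1 : ‖mom w‖ ^ 2 = ∑ i, mom w i ^ 2 := by rw [EuclideanSpace.real_norm_sq_eq]
  have hn2 : ‖d.U‖ ^ 2 = ∑ i, d.U i ^ 2 := by rw [EuclideanSpace.real_norm_sq_eq]
  unfold StrongPointData.relEnergyZ kineticEnergy
  rw [hn1, hn2]
  simp only [Fin.sum_univ_three]
  field_simp
  ring

/-! ## Transfer between the cut law and its smooth band extension -/

section Transfer

variable {η₁ σ : ℝ} {χ f : ℝ → ℝ}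

/-- At a reference state in the band interior, the cut law and the extension have the same pressure,
entropy and pressure derivatives. -/
theorem cm_ref_transfer {d : StrongPointData}
    (hχev : (fun x => cutCompressibility η₁ (x * σ ^ 3)) =ᶠ[𝓝 d.r] χ)
    (hχr : cutCompressibility η₁ (d.r * σ ^ 3) = χ d.r) (hfr : cutExcessFreeEnergy η₁ (d.r * σ ^ 3) = f d.r) :
    (cutEOS σ η₁).p d.r d.Θ = (EulerEOS.monatomicExcess χ f).p d.r d.Θ ∧
    (cutEOS σ η₁).s d.r d.Θ = (EulerEOS.monatomicExcess χ f).s d.r d.Θ ∧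
    d.pρ (cutEOS σ η₁) = d.pρ (EulerEOS.monatomicExcess χ f) ∧
    d.pϑ (cutEOS σ η₁) = d.pϑ (EulerEOS.monatomicExcess χ f) := by
  refine ⟨?_, ?_, ?_, ?_⟩
  · show d.r * d.Θ * cutCompressibility η₁ (d.r * σ ^ 3) = d.r * d.Θ * χ d.r
    rw [hχr]
  · show 3 / 2 * Real.log d.Θ - Real.log d.r - cutExcessFreeEnergy η₁ (d.r * σ ^ 3) =
      3 / 2 * Real.log d.Θ - Real.log d.r - f d.r
    rw [hfr]
  · unfold StrongPointData.pρ
    refine Filter.EventuallyEq.deriv_eq ?_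
    filter_upwards [hχev] with x hx
    show x * d.Θ * cutCompressibility η₁ (x * σ ^ 3) = x * d.Θ * χ x
    rw [hx]
  · unfold StrongPointData.pϑ
    congr 1
    funext θ
    show d.r * θ * cutCompressibility η₁ (d.r * σ ^ 3) = d.r * θ * χ d.r
    rw [hχr]

/-- In the essential region (both laws' clamps inactive, state in the band) the reduced right-hand sides,
the relative energies and the temperature equations of the cut law and of the extension coincide. -/
theorem cm_state_transfer {a b aB bB : ℝ} {d : StrongPointData} {w : EulerPhase}
    (hχev : (fun x => cutCompressibility η₁ (x * σ ^ 3)) =ᶠ[𝓝 d.r] χ)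
    (hχr : cutCompressibility η₁ (d.r * σ ^ 3) = χ d.r) (hfr : cutExcessFreeEnergy η₁ (d.r * σ ^ 3) = f d.r)
    (hχρ : cutCompressibility η₁ (dens w * σ ^ 3) = χ (dens w))
    (hfρ : cutExcessFreeEnergy η₁ (dens w * σ ^ 3) = f (dens w))
    (hsa : a ≤ (cutEOS σ η₁).s (dens w) (stateTemp (cutEOS σ η₁) (dens w) (ien w)))
    (hsb : (cutEOS σ η₁).s (dens w) (stateTemp (cutEOS σ η₁) (dens w) (ien w)) ≤ b)
    (hsBa : aB ≤ (EulerEOS.monatomicExcess χ f).s (dens w) (stateTemp (cutEOS σ η₁) (dens w) (ien w)))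
    (hsBb : (EulerEOS.monatomicExcess χ f).s (dens w) (stateTemp (cutEOS σ η₁) (dens w) (ien w)) ≤ bB) :
    reducedRHS (cutEOS σ η₁) (clamp a b) d (dens w) (ien w) (mom w) =
      reducedRHS (EulerEOS.monatomicExcess χ f) (clamp aB bB) d (dens w) (ien w) (mom w) ∧
    relEnergyFull (EulerEOS.monatomicExcess χ f) d (dens w) (ien w) (mom w) =
      relEnergyFull (cutEOS σ η₁) d (dens w) (ien w) (mom w) ∧
    (d.TemperatureEq (cutEOS σ η₁) ↔ d.TemperatureEq (EulerEOS.monatomicExcess χ f)) := by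
  have hstB : stateTemp (EulerEOS.monatomicExcess χ f) (dens w) (ien w) =
      stateTemp (cutEOS σ η₁) (dens w) (ien w) := rfl
  have hsρ : (cutEOS σ η₁).s (dens w) (stateTemp (cutEOS σ η₁) (dens w) (ien w)) =
      (EulerEOS.monatomicExcess χ f).s (dens w) (stateTemp (cutEOS σ η₁) (dens w) (ien w)) := by
    show 3 / 2 * Real.log (stateTemp (cutEOS σ η₁) (dens w) (ien w)) - Real.log (dens w) -
        cutExcessFreeEnergy η₁ (dens w * σ ^ 3) =
      3 / 2 * Real.log (stateTemp (cutEOS σ η₁) (dens w) (ien w)) - Real.log (dens w) - f (dens w)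
    rw [hfρ]
  have hZ : clamp a b ((cutEOS σ η₁).s (dens w) (stateTemp (cutEOS σ η₁) (dens w) (ien w))) =
      clamp aB bB ((EulerEOS.monatomicExcess χ f).s (dens w)
        (stateTemp (cutEOS σ η₁) (dens w) (ien w))) := by
    rw [clamp_eq_self hsa hsb, clamp_eq_self hsBa hsBb, hsρ]
  refine ⟨?_, ?_, ?_⟩
  · exact cm_reducedRHS_congr (χ₁ := fun x => cutCompressibility η₁ (x * σ ^ 3))
      (f₁ := fun x => cutExcessFreeEnergy η₁ (x * σ ^ 3)) hχev hfr hχρ hZ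
  · unfold relEnergyFull
    rw [hstB]
    congr 1
    exact cm_relEnergyThermo_congr (χ₂ := fun x => cutCompressibility η₁ (x * σ ^ 3))
      (f₂ := fun x => cutExcessFreeEnergy η₁ (x * σ ^ 3)) hχr.symm hfr.symm hfρ.symm
  · exact cm_temperatureEq_iff (f₁ := fun x => cutExcessFreeEnergy η₁ (x * σ ^ 3)) (f₂ := f) hχr

end Transfer


end Summit.AtomisticToContinuum.HydrodynamicLimit.Theorems.RES

end
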